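import Summits.AtomisticToContinuum.Crystallization.Theorems.OverbindingBudgetLocalRelaxationTrunc
import Summits.AtomisticToContinuum.Crystallization.Theorems.OverbindingBudgetPatchContinuity

/-!
# OverbindingBudget — the local relaxation test, IVa: lemmas for the transfer of an improving surgery (lens-4 g28)

Elementary lemmas (double-sum comparison, `2ε`-distortion, Lipschitz form of `V_LJ`, window-free shell by pigeonhole, positive distance
of finite sets) and the ONE tail estimate of the transfer argument (`truncGain_ge_base`).  Main theorem in part IVb
(`OverbindingBudgetImprovementTransfer`).  Overview of the argument:

`improvementTransfer_holds : ImprovementTransfer T₀ D` — in the clean class (uniformly discrete, uniformly recurrent, relatively dense)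
ONE improving surgery `(F₀, G₀)` with gain `g₀ > 0` gives `DenseImprovementT Y` with gain `g₀/4`:
* base truncation (the only tail estimate): `truncGain F₀ G₀ (Y ∩ B̄(0,r)) ≥ g₀/2` for `r ≥ ρ₀` (`finiteGain_eq` + dyadic tails);
* for `ρ ≥ ρ₀`: a window-free cut radius `r ∈ [ρ, 2ρ]` (pigeonhole over `#(Y ∩ B̄(0, 2ρ+1)) + 1` shells), an `ε`-matching of radius
  `2ρ + 2` from uniform recurrence near every point (covering radius `9/10`), the partner map `φ` (injective by `2ε < δ`), the transported
  patch `(φ(F₀), G₀ + g, φ(Y ∩ B̄(0,r)) = Y ∩ B̄(g, r))` (exact window correspondence thanks to the atom-free shell `| ‖w‖ − r | < 3ε`),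
  disjointness of `G₀ + g` from `Y ∖ φ(F₀)` (`ε < dist(G₀, Y ∖ F₀)/2`), and the term-by-term Lipschitz comparison of the four finite sums
  (`|V(s) − V(t)| ≤ (m⁻¹³ + m⁻⁷)|s − t|`), error `≤ ε K ≤ g₀/4`.
Hence **`localRelaxationTest_holds : LocalRelaxationTest T₀ D` for all `T₀, D`** (part III), in particular the RDEF-cone hypothesis
`LocalRelaxationTest (1/250) 10` of `rdef_of_grossU_shearSplit_record`.
-/

noncomputable section

open Metric Set
open scoped BigOperators
open Literature.MathematicalPhysics.StatisticalMechanics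
open Summit.AtomisticToContinuum.Crystallization.Theorems.OverbindingBudgetEdgeRelaxationStatements
open Summit.AtomisticToContinuum.Crystallization.Theorems.OverbindingBudgetRecurrentSealStatements (UniformlyRecurrent)
open Summit.AtomisticToContinuum.Crystallization.Theorems.OverbindingBudgetElasticSplitStatements (surgeryGain LocallyOptimal LocalRelaxationTest)
open Summit.AtomisticToContinuum.Crystallization.Theorems.OverbindingBudgetCubeTails
open Summit.AtomisticToContinuum.Crystallization.Theorems.OverbindingBudgetPatchContinuity (abs_lennardJones_sub_le)
open Summit.AtomisticToContinuum.Crystallization.Theorems.OverbindingBudgetLocalRelaxationCut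
open Summit.AtomisticToContinuum.Crystallization.Theorems.OverbindingBudgetLocalRelaxationTrunc

namespace Summit.AtomisticToContinuum.Crystallization.Theorems.OverbindingBudgetImprovementTransferLemmas

/-! ## §1  Elementary lemmas -/

/-- double sums with termwise-close summands are close. -/
theorem abs_sum_sum_sub_le {A B : Finset (EuclideanSpace ℝ (Fin 3))}
    {u v : EuclideanSpace ℝ (Fin 3) → EuclideanSpace ℝ (Fin 3) → ℝ} {c : ℝ} (h : ∀ a ∈ A, ∀ b ∈ B, |u a b - v a b| ≤ c) :
    |∑ a ∈ A, ∑ b ∈ B, u a b - ∑ a ∈ A, ∑ b ∈ B, v a b| ≤ A.card * (B.card * c) := by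
  rw [← Finset.sum_sub_distrib]
  calc |∑ a ∈ A, (∑ b ∈ B, u a b - ∑ b ∈ B, v a b)| ≤ ∑ a ∈ A, |∑ b ∈ B, u a b - ∑ b ∈ B, v a b| :=
        Finset.abs_sum_le_sum_abs _ _
    _ ≤ ∑ a ∈ A, B.card * c := Finset.sum_le_sum fun a ha => by
        rw [← Finset.sum_sub_distrib]
        calc |∑ b ∈ B, (u a b - v a b)| ≤ ∑ b ∈ B, |u a b - v a b| := Finset.abs_sum_le_sum_abs _ _
          _ ≤ ∑ b ∈ B, c := Finset.sum_le_sum (h a ha)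
          _ = B.card * c := by rw [Finset.sum_const, nsmul_eq_mul]
    _ = A.card * (B.card * c) := by rw [Finset.sum_const, nsmul_eq_mul]

/-- a rigid motion up to `ε` distorts distances by `≤ 2ε`. -/
theorem abs_dist_transport {a a' b b' g : EuclideanSpace ℝ (Fin 3)} {ε : ℝ} (ha : dist a' (a + g) ≤ ε) (hb : dist b' (b + g) ≤ ε) :
    |dist a' b' - dist a b| ≤ 2 * ε := by
  have h0 : dist (a + g) (b + g) = dist a b := dist_add_right a b g
  have h1 := dist_triangle4 a' (a + g) (b + g) b'
  have h2 := dist_triangle4 (a + g) a' b' (b + g)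
  rw [dist_comm (b + g) b'] at h1
  rw [dist_comm (a + g) a'] at h2
  rw [abs_le]; constructor <;> linarith

/-- Lipschitz continuity of `V_LJ` on `[m, ∞)` against a distance perturbation `≤ η`. -/
theorem abs_lennardJones_sub_le_of_abs_le {m s t η : ℝ} (hm : 0 < m) (hs : m ≤ s) (ht : m ≤ t) (hst : |s - t| ≤ η) :
    |lennardJones s - lennardJones t| ≤ (m⁻¹ ^ 13 + m⁻¹ ^ 7) * η :=
  (abs_lennardJones_sub_le hm hs ht).trans (mul_le_mul_of_nonneg_left hst (by positivity))

/-- **pigeonhole for a window-free shell**: among the `#S + 1` shells of width `ρ/(#S+1)` partitioning `ρ ≤ ‖w‖ < 2ρ` one contains no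
point of `S`. -/
theorem exists_free_shell (S : Finset (EuclideanSpace ℝ (Fin 3))) {ρ : ℝ} (hρ : 0 < ρ) :
    ∃ j : ℕ, j ≤ S.card ∧ ∀ w ∈ S, ‖w‖ < ρ + j * (ρ / (S.card + 1)) ∨ ρ + (j + 1) * (ρ / (S.card + 1)) ≤ ‖w‖ := by
  set ω : ℝ := ρ / (S.card + 1) with hω
  have hωpos : 0 < ω := by positivity
  set f : EuclideanSpace ℝ (Fin 3) → ℕ := fun w => ⌊(‖w‖ - ρ) / ω⌋₊ with hf
  have hlt : (S.image f).card < (Finset.range (S.card + 1)).card := by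
    rw [Finset.card_range]; exact Nat.lt_succ_of_le Finset.card_image_le
  obtain ⟨j, hj, hjS⟩ := Finset.exists_mem_notMem_of_card_lt_card hlt
  refine ⟨j, Nat.le_of_lt_succ (Finset.mem_range.1 hj), fun w hw => ?_⟩
  by_contra h
  push Not at h
  obtain ⟨h1, h2⟩ := h
  apply hjS
  rw [Finset.mem_image]
  refine ⟨w, hw, ?_⟩
  rw [hf]
  simp only
  rw [Nat.floor_eq_iff]
  · constructor
    · rw [le_div_iff₀ hωpos]; linarith
    · rw [div_lt_iff₀ hωpos]; linarith
  · exact div_nonneg (by nlinarith [(Nat.cast_nonneg j : (0 : ℝ) ≤ j)]) hωpos.le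

/-- a finite set avoiding a finite set keeps a positive distance `≤ 1` from it. -/
theorem exists_pos_le_dist (A S : Finset (EuclideanSpace ℝ (Fin 3))) (h : ∀ x ∈ A, ∀ w ∈ S, x ≠ w) :
    ∃ η : ℝ, 0 < η ∧ η ≤ 1 ∧ ∀ x ∈ A, ∀ w ∈ S, η ≤ dist x w := by
  by_cases hne : (A ×ˢ S).Nonempty
  · obtain ⟨q, hq, hmin⟩ := (A ×ˢ S).exists_min_image (fun q => dist q.1 q.2) hne
    have hq' := Finset.mem_product.1 hq
    have hpos : 0 < dist q.1 q.2 := dist_pos.2 (h _ hq'.1 _ hq'.2)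
    exact ⟨min 1 (dist q.1 q.2), lt_min one_pos hpos, min_le_left _ _,
      fun x hx w hw => (min_le_right _ _).trans (hmin (x, w) (Finset.mem_product.2 ⟨hx, hw⟩))⟩
  · exact ⟨1, one_pos, le_rfl, fun x hx w hw => absurd ⟨(x, w), Finset.mem_product.2 ⟨hx, hw⟩⟩ hne⟩

/-! ## §2  Base truncation: the one tail estimate -/

/-- **truncation at the base patch**: if `F₀ ⊆ W₀ ⊆ Y`, all atoms of `F₀ ∪ G₀` have norm `≤ R₁`, every site of `Y` outside `W₀` has norm
`> r`, and `δ ≤ r − R₁`, then `truncGain F₀ G₀ W₀ ≥ surgeryGain Y F₀ G₀ − 2 #F₀ · 432(δ⁻⁶+1)δ⁻³(r − R₁)⁻³`. -/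
theorem truncGain_ge_base {Y : Set (EuclideanSpace ℝ (Fin 3))} (hUD : UniformlyDiscrete Y) {δ : ℝ} (hδ : 0 < δ)
    (hsep : ∀ x ∈ Y, ∀ z ∈ Y, x ≠ z → δ ≤ dist x z) {F₀ G₀ W₀ : Finset (EuclideanSpace ℝ (Fin 3))} (hF₀W₀ : F₀ ⊆ W₀)
    (hW₀Y : (↑W₀ : Set (EuclideanSpace ℝ (Fin 3))) ⊆ Y) (hcard : G₀.card = F₀.card) {R₁ r : ℝ} (hδu : δ ≤ r - R₁)
    (hFn : ∀ a ∈ F₀, ‖a‖ ≤ R₁) (hGn : ∀ a ∈ G₀, ‖a‖ ≤ R₁) (hout : ∀ z ∈ Y, z ∉ W₀ → r < ‖z‖) :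
    surgeryGain Y F₀ G₀ - 2 * F₀.card * (432 * (δ⁻¹ ^ 6 + 1) * δ⁻¹ ^ 3 * (r - R₁)⁻¹ ^ 3) ≤ truncGain F₀ G₀ W₀ := by
  have e := finiteGain_eq hUD G₀ hF₀W₀ hW₀Y
  unfold truncGain
  rw [e]
  have htail : ∀ a : EuclideanSpace ℝ (Fin 3), ‖a‖ ≤ R₁ →
      |∑' w : ↥(Y \ ↑W₀), lennardJones (dist a (w : EuclideanSpace ℝ (Fin 3)))| ≤
        432 * (δ⁻¹ ^ 6 + 1) * δ⁻¹ ^ 3 * (r - R₁)⁻¹ ^ 3 := by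
    intro a ha
    refine abs_tsum_lennardJones_le_dyadic a hδ hδu ?_ ?_
    · rintro z ⟨hzY, hzW⟩
      have hz := hout z hzY (fun h => hzW (Finset.mem_coe.2 h))
      have h1 : ‖z‖ - ‖a‖ ≤ ‖z - a‖ := norm_sub_norm_le z a
      rw [dist_comm, dist_eq_norm]
      linarith
    · rintro z ⟨hzY, -⟩ w ⟨hwY, -⟩ hne
      exact hsep z hzY w hwY hne
  have sF : |∑ a ∈ F₀, ∑' w : ↥(Y \ ↑W₀), lennardJones (dist a (w : EuclideanSpace ℝ (Fin 3)))| ≤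
      F₀.card * (432 * (δ⁻¹ ^ 6 + 1) * δ⁻¹ ^ 3 * (r - R₁)⁻¹ ^ 3) := by
    calc _ ≤ ∑ a ∈ F₀, |∑' w : ↥(Y \ ↑W₀), lennardJones (dist a (w : EuclideanSpace ℝ (Fin 3)))| := Finset.abs_sum_le_sum_abs _ _
      _ ≤ ∑ a ∈ F₀, 432 * (δ⁻¹ ^ 6 + 1) * δ⁻¹ ^ 3 * (r - R₁)⁻¹ ^ 3 := Finset.sum_le_sum fun a ha => htail a (hFn a ha)
      _ = _ := by rw [Finset.sum_const, nsmul_eq_mul]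
  have sG : |∑ a ∈ G₀, ∑' w : ↥(Y \ ↑W₀), lennardJones (dist a (w : EuclideanSpace ℝ (Fin 3)))| ≤
      F₀.card * (432 * (δ⁻¹ ^ 6 + 1) * δ⁻¹ ^ 3 * (r - R₁)⁻¹ ^ 3) := by
    calc _ ≤ ∑ a ∈ G₀, |∑' w : ↥(Y \ ↑W₀), lennardJones (dist a (w : EuclideanSpace ℝ (Fin 3)))| := Finset.abs_sum_le_sum_abs _ _
      _ ≤ ∑ a ∈ G₀, 432 * (δ⁻¹ ^ 6 + 1) * δ⁻¹ ^ 3 * (r - R₁)⁻¹ ^ 3 := Finset.sum_le_sum fun a ha => htail a (hGn a ha)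
      _ = _ := by rw [Finset.sum_const, nsmul_eq_mul, hcard]
  rw [abs_le] at sF sG
  linarith [sF.1, sF.2, sG.1, sG.2]

end Summit.AtomisticToContinuum.Crystallization.Theorems.OverbindingBudgetImprovementTransferLemmas

end
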